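import Mathlib.NumberTheory.ArithmeticFunction.Moebius
import Mathlib.NumberTheory.PrimeCounting
import Mathlib.Analysis.SpecialFunctions.Pow.Real
import Mathlib.Analysis.Calculus.ContDiff.Basic
import Mathlib.MeasureTheory.Integral.IntervalIntegral.Basic
import HarnessLib

/-!
# Goldston–Graham–Pintz–Yıldırım 2009: the sieve mean-value Lemmas 3 and 4 in dimension `κ = 1` (Maynard's Lemma 6.1)

Topic `Literature/NumberTheory/Sieve`. D. A. Goldston, S. W. Graham, J. Pintz, C. Y. Yıldırım,
*Small gaps between products of two primes*, Proc. Lond. Math. Soc. (3) 98 (2009), 741–774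
(doi:10.1112/plms/pdn046 = arXiv:math/0609615), §2 "Notation and preliminary lemmas", p. 6 of the
arXiv text: the two mean-value lemmas for sums `∑_{d<z} μ(d)² g(d)` of a multiplicative `g` of sieve
dimension `κ`, quoted by J. Maynard, *Small gaps between primes*, Ann. of Math. 181 (2015) as his
Lemma 6.1 ("This is [5, Lemma 4], with slight changes to the notation") and used there — as in
GGPY itself — only with `κ = 1` (proofs of Lemmas 6.2 and 6.3). Both are vendored here as NAMED
FACTS **in dimension `κ = 1`** (deep inputs: Lemma 3 "is a combination of Lemmas 5.3 and 5.4 of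
Halberstam and Richert's book" [H. Halberstam, H.-E. Richert, *Sieve Methods*, Academic Press 1974];
Lemma 4 follows from Lemma 3 by partial summation, proof printed on pp. 6–7):

* the hypotheses `(Ω₁)`: `0 ≤ γ(p)/p ≤ 1 − 1/A₁` (`GGPY.HypOmega1`) and `(Ω₂(κ, L))`:
  `−L ≤ ∑_{w ≤ p < z} γ(p) log p/p − κ log(z/w) ≤ A₂` for `2 ≤ w ≤ z` (`GGPY.HypOmega2`);
* `g(d) = ∏_{p ∣ d} γ(p)/(p − γ(p))` (`GGPY.g`) and, for `κ = 1`, the constant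
  `c_γ = ∏_p (1 − γ(p)/p)⁻¹ (1 − 1/p)` (`GGPY.cGamma`, the limit of the partial products
  `GGPY.cGammaPartial` over `p < y`; the product converges only conditionally in general, and its
  convergence under `(Ω₁)`, `(Ω₂)` is part of the content of Halberstam–Richert's Lemma 5.3,
  recorded in the vendored statement);
* `GGPY.moebiusSqGSum_asymptotic` — **Lemma 3 with `κ = 1`**:
  `∑_{d<z} μ(d)² g(d) = c_γ log z · {1 + O(L/log z)}`, the implied constant depending on `A₁, A₂`
  only ("independent of `L`");
* `GGPY.moebiusSqGSumWeighted_asymptotic` — **Lemma 4 with `κ = 1`** (= Maynard's Lemma 6.1 as he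
  uses it): for `F : [0,1] → ℝ` (here: `C¹`; the source allows piecewise differentiable `F`) with
  `M(F) = sup (|F| + |F'|)`,
  `∑_{d<z} μ(d)² g(d) F(log(z/d)/log z) = c_γ log z ∫₀¹ F(1−x) dx + O(c_γ L M(F))`,
  the implied constant depending on `A₁, A₂` only ("independent of `L` and `F`").

Why `κ = 1` only. The printed lemmas are stated for all `κ > 0` with the error uniform in `L` and
in `z ≥ 2`; read literally this is false for `κ > 1` at `log z ≲ L`: with `γ(p) = 0` for
`p < Y = exp(L/(2κ))` and `γ(p) = κ` beyond, `(Ω₁)`, `(Ω₂(κ, L))` hold with fixed `A₁, A₂`, while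
`c_γ ≍_κ L^{−κ}`, so at `z = 2` the left side `|1 − c_γ (log 2)^κ/Γ(κ+1)| → 1` but the bound
`C c_γ L (log 2)^{κ−1} ≍ C L^{1−κ} → 0` (observation of the tree's review of the first vendoring).
For `κ = 1` one has `c_γ ≫ 1/L` under `(Ω₁)`, `(Ω₂(1, L))`, the bound `O(c_γ L)` dominates for
`log z ≲ L`, and the uniform reading is the one sieve texts use; it is also the only case GGPY
(§§3–9) and Maynard (Lemmas 6.2, 6.3) apply. We therefore vendor the `κ = 1` statements.

Relation to the tree. `CoprimeSquarefreeSumsSmooth.lean` PROVES the `κ = 1` case of Lemma 4 for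
the W-trick weights `μ²(n) 1_{(n,W)=1} ∏_{p∣n}(1+c_p)/n` with `W` the product of ALL primes
`≤ D₀` (`SquarefreeSums.abs_sum_wfun_smooth_sub_le`), with an error carrying the divisor-type
constant `harmErr W` and a relative error `D₀^{−1/4}`; that covers Maynard's (6.5)–(6.7) and
(6.12)–(6.14) (modulus `W`) but NOT the evaluation of `y^{(m)}` in the proof of Lemma 6.3, whose
modulus is `W ∏ rᵢ` (not smooth, `log(W∏rᵢ) ≍ log R`), where only the `L ≪ ∑_{p ∣ W∏rᵢ} log p/p`
dependence of the genuine Lemma 6.1 is small enough. The facts below are that genuine lemma; they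
are not independent of `abs_sum_wfun_smooth_sub_le` (which is a special case with an explicit but
weaker error).

Conventions. Only the values `γ(p)` at primes enter (the source's "`γ` multiplicative" is
immaterial and is not imposed). `d < z`, `w ≤ p < z` for real `w, z` are written with `⌈·⌉₊`
(`d < z ↔ d < ⌈z⌉₊` for integers `d`). The facts are stated for `L ≥ 1` and `z ≥ 2` (the source:
`L > 0`; weaker as vendored), with explicit absolute-value bounds in place of `O(·)`.

## References

* D. A. Goldston, S. W. Graham, J. Pintz, C. Y. Yıldırım, *Small gaps between products of two
  primes*, Proc. Lond. Math. Soc. (3) 98 (2009), 741–774, doi:10.1112/plms/pdn046,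
  arXiv:math/0609615 [GoldstonEtAl2008]: §2, displays (2.2)–(2.4) (hypotheses `(Ω₁)`, `(Ω₂)` and `g`),
  Lemma 3, Lemma 4 and its proof (pp. 6–7 of the arXiv text).
* H. Halberstam, H.-E. Richert, *Sieve Methods*, Academic Press 1974, Ch. 5, Lemmas 5.3, 5.4
  (the source of Lemma 3).
* J. Maynard, *Small gaps between primes*, Ann. of Math. (2) 181 (2015), 383–413, Lemma 6.1
  [MaynardAnnals2015].
-/

noncomputable section

open Finset Filter
open scoped Topology ArithmeticFunction.Moebius

namespace Literature.NumberTheory.Sieve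

namespace GGPY

/-- Hypothesis `(Ω₁)` of Goldston–Graham–Pintz–Yıldırım 2009 (display (2.2); Halberstam–Richert's
`(Ω₁)`): `0 ≤ γ(p)/p ≤ 1 − 1/A₁` for every prime `p`. [cite: GoldstonEtAl2008, §2 display (2.2), hypothesis (Ω₁) of Lemma 3] -/
def HypOmega1 (γ : ℕ → ℝ) (A₁ : ℝ) : Prop :=
  ∀ p : ℕ, p.Prime → 0 ≤ γ p / p ∧ γ p / p ≤ 1 - 1 / A₁

/-- The prime sum `∑_{w ≤ p < z} γ(p) log p / p` of hypothesis `(Ω₂)` (real `w, z`; the primes `p`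
with `w ≤ p < z` are those with `⌈w⌉₊ ≤ p < ⌈z⌉₊`). [cite: GoldstonEtAl2008, §2 display (2.3)] -/
def omega2Sum (γ : ℕ → ℝ) (w z : ℝ) : ℝ :=
  ∑ p ∈ (Finset.Ico ⌈w⌉₊ ⌈z⌉₊).filter Nat.Prime, γ p * Real.log p / p

/-- Hypothesis `(Ω₂(κ, L))` of Goldston–Graham–Pintz–Yıldırım 2009 (display (2.3); Halberstam–Richert's
`(Ω₂(κ, L))`), with the constant `A₂`: for all `2 ≤ w ≤ z`,
`−L ≤ ∑_{w ≤ p < z} γ(p) log p/p − κ log(z/w) ≤ A₂`. [cite: GoldstonEtAl2008, §2 display (2.3), hypothesis (Ω₂) of Lemma 3] -/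
def HypOmega2 (γ : ℕ → ℝ) (κ A₂ L : ℝ) : Prop :=
  ∀ w z : ℝ, 2 ≤ w → w ≤ z →
    -L ≤ omega2Sum γ w z - κ * Real.log (z / w) ∧ omega2Sum γ w z - κ * Real.log (z / w) ≤ A₂

/-- `g(d) = ∏_{p ∣ d} γ(p)/(p − γ(p))`, the multiplicative function of display (2.4) (only its
values at squarefree `d` are used, through `μ(d)² g(d)`). [cite: GoldstonEtAl2008, §2 display (2.4)] -/
def g (γ : ℕ → ℝ) (d : ℕ) : ℝ :=
  ∏ p ∈ d.primeFactors, γ p / ((p : ℝ) - γ p)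

/-- The partial products `∏_{p < y} (1 − γ(p)/p)⁻¹ (1 − 1/p)` of the constant `c_γ` of Lemma 3 in
dimension `κ = 1`. [cite: GoldstonEtAl2008, Lemma 3 (definition of c_γ), κ = 1] -/
def cGammaPartial (γ : ℕ → ℝ) (y : ℕ) : ℝ :=
  ∏ p ∈ Nat.primesBelow y, (1 - γ p / p)⁻¹ * (1 - 1 / (p : ℝ))

/-- The constant `c_γ = ∏_p (1 − γ(p)/p)⁻¹ (1 − 1/p)` of Lemma 3 (dimension `κ = 1`), as the limit
of its partial products over `p < y`, `y → ∞` (the product converges, in this order, under `(Ω₁)`,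
`(Ω₂)`; in general only conditionally, so it is NOT written as an unconditional `∏'`). Junk value if
the limit does not exist. (Named `cGamma`, not `singularSeries`, to avoid the tuple singular series
`Literature.NumberTheory.Sieve.singularSeries`.) [cite: GoldstonEtAl2008, Lemma 3 (definition of c_γ), κ = 1] -/
def cGamma (γ : ℕ → ℝ) : ℝ :=
  limUnder atTop (cGammaPartial γ)

/-- The sum `∑_{d < z} μ(d)² g(d)` of Lemma 3 (`d` over the positive integers below `z`).
[cite: GoldstonEtAl2008, Lemma 3] -/
def moebiusSqGSum (γ : ℕ → ℝ) (z : ℝ) : ℝ :=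
  ∑ d ∈ Finset.Ico 1 ⌈z⌉₊, ((μ d : ℤ) : ℝ) ^ 2 * g γ d

/-- The weighted sum `∑_{d < z} μ(d)² g(d) F(log(z/d)/log z)` of Lemma 4.
[cite: GoldstonEtAl2008, Lemma 4, display (2.5)] -/
def moebiusSqGSumWeighted (γ : ℕ → ℝ) (F : ℝ → ℝ) (z : ℝ) : ℝ :=
  ∑ d ∈ Finset.Ico 1 ⌈z⌉₊, ((μ d : ℤ) : ℝ) ^ 2 * g γ d * F (Real.log (z / d) / Real.log z)

/-- **Goldston–Graham–Pintz–Yıldırım 2009, Lemma 3, in dimension `κ = 1`** (= Halberstam–Richert,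
*Sieve Methods*, Lemmas 5.3 and 5.4 combined, `κ = 1`). Suppose `A₁, A₂, L > 0`, `γ` satisfies
`(Ω₁)` with `A₁` and `(Ω₂(1, L))` with `A₂`, and `g(d) = ∏_{p∣d} γ(p)/(p − γ(p))`. Then
`∑_{d<z} μ(d)² g(d) = c_γ log z · {1 + O(L/log z)}`, `c_γ = ∏_p (1 − γ(p)/p)⁻¹ (1 − 1/p)`,
"the constant implied by `O` may depend on `A₁, A₂, κ`, but it is independent of `L`" (and of
`γ`). Vendored (for `κ = 1` only, see the module docstring for why) as: for fixed `A₁, A₂` there is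
`C` such that for every `L ≥ 1` and every `γ` satisfying the two hypotheses, the partial products of
`c_γ` converge to `c_γ` (`cGamma`; part of the content of Halberstam–Richert's Lemma 5.3) and, for
all `z ≥ 2`, `|∑_{d<z} μ(d)² g(d) − c_γ log z| ≤ C c_γ L`. A deep input, vendored as a named fact.
[cite: GoldstonEtAl2008, Lemma 3 (κ = 1)] -/
def moebiusSqGSum_asymptotic : Prop :=
  ∀ (A₁ A₂ : ℝ), 0 < A₁ → 0 < A₂ → ∃ C : ℝ, ∀ (L : ℝ), 1 ≤ L →
    ∀ (γ : ℕ → ℝ), HypOmega1 γ A₁ → HypOmega2 γ 1 A₂ L →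
      Tendsto (cGammaPartial γ) atTop (𝓝 (cGamma γ)) ∧
      ∀ z : ℝ, 2 ≤ z →
        |moebiusSqGSum γ z - cGamma γ * Real.log z| ≤ C * cGamma γ * L

/-- **Goldston–Graham–Pintz–Yıldırım 2009, Lemma 4, in dimension `κ = 1`** (= Maynard 2015,
Lemma 6.1, in the only case Maynard uses). Under the hypotheses of Lemma 3 (`κ = 1`) and for
`F : [0, 1] → ℝ` piecewise differentiable with `M(F) = sup {|F(x)| + |F'(x)| : 0 ≤ x ≤ 1}`,
`∑_{d<z} μ(d)² g(d) F(log(z/d)/log z) = c_γ log z ∫₀¹ F(1−x) dx + O(c_γ L M(F))`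
(the printed `(log z)^κ/Γ(κ) ∫₀¹ F(1−x) x^{κ−1} dx` and `O(c_γ L M(F) (log z)^{κ−1})` at `κ = 1`),
"the constant implied by `O` may depend on `A₁, A₂` and `κ`, but it is independent of `L` and `F`".
Vendored for `F ∈ C¹(ℝ)` (a sub-case of "piecewise differentiable"; functions cut off at a point
`c ∈ (0, 1]` are recovered by applying the statement at `z^c`) and any `M ≥ sup_{[0,1]} (|F| + |F'|)`,
with `L ≥ 1`, `z ≥ 2`, as an explicit bound. (Proof in the source, pp. 6–7: Stieltjes integration
against `G(u) = ∑_{d<u} μ² g = c_γ log u + E(u)` from Lemma 3, the substitution `u = z^x` in the main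
term and integration by parts on `∫ F dE`.) The tree's `SquarefreeSums.abs_sum_wfun_smooth_sub_le`
(`CoprimeSquarefreeSumsSmooth.lean`) is the special case `γ = 1_{p ∤ W}` for `W = ∏_{p ≤ D₀} p`
with a weaker, `W`-dependent error; the present general form is what the evaluation of `y^{(m)}`
in the proof of Maynard's Lemma 6.3 (modulus `W ∏ rᵢ`) needs. A deep input, vendored as a named
fact. [cite: GoldstonEtAl2008, Lemma 4 (κ = 1)] -/
def moebiusSqGSumWeighted_asymptotic : Prop :=
  ∀ (A₁ A₂ : ℝ), 0 < A₁ → 0 < A₂ → ∃ C : ℝ, ∀ (L : ℝ), 1 ≤ L →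
    ∀ (γ : ℕ → ℝ), HypOmega1 γ A₁ → HypOmega2 γ 1 A₂ L →
    ∀ (F : ℝ → ℝ), ContDiff ℝ 1 F →
    ∀ (M : ℝ), (∀ x ∈ Set.Icc (0 : ℝ) 1, |F x| + |deriv F x| ≤ M) →
      ∀ z : ℝ, 2 ≤ z →
        |moebiusSqGSumWeighted γ F z - cGamma γ * Real.log z * ∫ x in (0 : ℝ)..1, F (1 - x)| ≤
          C * cGamma γ * L * M

/-! ### Elementary API -/

/-- `g(1) = 1`. [folklore] -/
theorem g_one (γ : ℕ → ℝ) : g γ 1 = 1 := by simp [g]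

/-- `g(p) = γ(p)/(p − γ(p))` at a prime. [cite: GoldstonEtAl2008, §2 display (2.4)] -/
theorem g_prime (γ : ℕ → ℝ) {p : ℕ} (hp : p.Prime) : g γ p = γ p / ((p : ℝ) - γ p) := by
  simp [g, hp.primeFactors]

/-- `g` is multiplicative on coprime arguments (`≠ 0`). [cite: GoldstonEtAl2008, §2 ("Let g be the multiplicative function defined by (2.4)")] -/
theorem g_mul_of_coprime (γ : ℕ → ℝ) {m n : ℕ} (hmn : m.Coprime n) :
    g γ (m * n) = g γ m * g γ n := by
  unfold g
  rw [hmn.primeFactors_mul, Finset.prod_union hmn.disjoint_primeFactors]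

/-- For `γ ≡ 1` off the primes dividing `P` and `γ = 0` on them (Maynard's choice in Lemmas 6.2, 6.3),
the partial products of `c_γ` are eventually constant, equal to `∏_{p ∣ P} (1 − 1/p)`: every factor
with `p ∤ P` is `1`. [cite: MaynardAnnals2015, proof of Lemma 6.2 (choice of γ)] -/
theorem cGammaPartial_indicator {P : ℕ} (hP : P ≠ 0) {y : ℕ} (hy : P < y) :
    cGammaPartial (fun p => if p ∣ P then 0 else 1) y = ∏ p ∈ P.primeFactors, (1 - 1 / (p : ℝ)) := by
  unfold cGammaPartial
  rw [← Finset.prod_filter_mul_prod_filter_not (Nat.primesBelow y) (fun p => p ∣ P)]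
  have h1 : ∏ p ∈ (Nat.primesBelow y).filter (fun p => ¬p ∣ P),
      ((1 - (if p ∣ P then (0 : ℝ) else 1) / p)⁻¹ * (1 - 1 / (p : ℝ))) = 1 := by
    refine Finset.prod_eq_one fun p hp => ?_
    rw [Finset.mem_filter] at hp
    have hpp := (Nat.mem_primesBelow.1 hp.1).2
    have hp1 : (1 : ℝ) - 1 / p ≠ 0 := by
      have : (1 : ℝ) < p := by exact_mod_cast hpp.one_lt
      have : 1 / (p : ℝ) < 1 := by rw [div_lt_one (by linarith)]; exact this
      linarith
    rw [if_neg hp.2, one_div, inv_mul_cancel₀]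
    rwa [one_div] at hp1
  rw [h1, mul_one]
  have h2 : (Nat.primesBelow y).filter (fun p => p ∣ P) = P.primeFactors := by
    ext p
    simp only [Finset.mem_filter, Nat.mem_primesBelow, Nat.mem_primeFactors]
    constructor
    · rintro ⟨⟨-, hp⟩, hdvd⟩; exact ⟨hp, hdvd, hP⟩
    · rintro ⟨hp, hdvd, -⟩
      exact ⟨⟨lt_of_le_of_lt (Nat.le_of_dvd (Nat.pos_of_ne_zero hP) hdvd) hy, hp⟩, hdvd⟩
  rw [h2]
  refine Finset.prod_congr rfl fun p hp => ?_
  have hdvd : p ∣ P := Nat.dvd_of_mem_primeFactors hp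
  simp only [if_pos hdvd, zero_div, sub_zero, inv_one, one_mul]

/-- Hence, for that `γ`, `c_γ = ∏_{p ∣ P} (1 − 1/p) = φ(P)/P` and the partial products converge to it
(so the convergence clause of `moebiusSqGSum_asymptotic` is automatic in Maynard's applications).
[cite: MaynardAnnals2015, proof of Lemma 6.2 (choice of γ)] -/
theorem cGamma_indicator {P : ℕ} (hP : P ≠ 0) :
    Tendsto (cGammaPartial (fun p => if p ∣ P then 0 else 1)) atTop
        (𝓝 (∏ p ∈ P.primeFactors, (1 - 1 / (p : ℝ)))) ∧
      cGamma (fun p => if p ∣ P then 0 else 1) = ∏ p ∈ P.primeFactors, (1 - 1 / (p : ℝ)) := by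
  have ht : Tendsto (cGammaPartial (fun p => if p ∣ P then 0 else 1)) atTop
      (𝓝 (∏ p ∈ P.primeFactors, (1 - 1 / (p : ℝ)))) := by
    refine tendsto_const_nhds.congr' ?_
    filter_upwards [eventually_gt_atTop P] with y hy
    exact (cGammaPartial_indicator hP hy).symm
  exact ⟨ht, ht.limUnder_eq⟩

end GGPY

end Literature.NumberTheory.Sieve
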